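import Literature.MeasureTheory.Group.FaddeevPopovAveraging
import Mathlib.MeasureTheory.Measure.WithDensity
import Mathlib.MeasureTheory.Integral.Bochner.Basic
import Mathlib.MeasureTheory.Constructions.BorelSpace.Basic
import Mathlib.Topology.Algebra.Group.Pointwise
import Mathlib.Topology.Sequences
import HarnessLib

/-!
# The invariant tube around an orbit: a local product chart globalises by averaging
(the measure half of the slice ∕ tube theorem for a group action, Helgason's averaging device)

Topic `MeasureTheory/Group`; namespace `Literature.MeasureTheory.Group`.  Proof file: theorems only, no
definitions, no named facts.  Instance-free in the action (an explicit jointly measurable family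
`act : K → X → X` of `μ`-preserving maps with `act (k k') = act k ∘ act k'`, `act 1 = id`, as in
`FaddeevPopovAveraging.lean`), so that it applies verbatim to lattice gauge transformations
(`gaugeAct g U`, which is not a registered `MulAction`).

THE SETTING.  A group `K` with an s-finite measure `ν` (left-invariant where said; think: a compact group
with a Haar measure) acts on a measure space `(X, μ)` by `μ`-preserving maps.  A «transversal» is a
measurable map `σ : Y → X` from a parameter space `(Y, ρ)` (any s-finite measure; think: Lebesgue measure
on a linear slice through `x₀ = σ y₀`), restricted to a measurable window `B ⊆ Y`; the TUBE MAP is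
`Θ (k, y) = act k (σ y)` on `K × Y` and the tube is `T = Θ(K × B) = K • σ(B)`.  A LOCAL WINDOW of the group
directions is given through an arbitrary parametrisation `e : Z → K` of a measurable `Φ ⊆ Z` carrying an
s-finite measure `κ` (think: `Z = 𝔨`, `e = exp`, `κ` = Lebesgue, `Φ` a small ball — or simply `Z = K`,
`e = id`, `κ = ν`), with window map `Θ' (z, y) = act (e z) (σ y)` and window `A = Θ'(Φ × B)`.

THE RESULTS (all PROVED).

* §1 `lintegral_window_orbitAverage_eq` (chart-free, no invariance of `ν` needed): for every measurable
  window `A ⊆ X` and measurable `g ≥ 0`,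
  `∫_A (∫_K g(act k x) dν(k)) dμ(x) = ∫_X g(x) · ν{k | act k⁻¹ x ∈ A} dμ(x)` — Tonelli and the invariance
  of `μ`; the weight `m_A(x) = ν{k | act k⁻¹ x ∈ A}` is the «fibre mass» of the window over the orbit
  through `x`.
* §2 the fibre mass of a product window under the SLICE PROPERTY
  «`act k (σ y) = σ y'` with `y, y' ∈ B` forces `k ∈ S`», `S ⊆ K` a set fixing `σ(B)` pointwise (the common
  stabiliser; `S = Z_N` for twist-eating lattice vacua): `m_A = ν(((e Φ)·S)⁻¹)` on the tube `T` and `0` off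
  it (`fibre_set_eq_of_slice`, `fibre_set_eq_empty_of_not_mem_tube`), hence
  `ν(((eΦ)·S)⁻¹) · ∫_T g dμ = ∫_A ḡ dμ` (`measure_mul_lintegral_tube_eq_window_orbitAverage`).
* §3 ★ GLOBALISATION OF A LOCAL PRODUCT CHART.  If on the window the measure is known in product
  coordinates — `μ|_A = Θ'_*(((κ ⊗ ρ)|_{Φ × B}) · J)` for a measurable density `J ≥ 0` on `Z × Y` (what an
  inverse-function-theorem chart at `(1, y₀)` composed with a chart of `X` delivers LOCALLY) — then
  GLOBALLY, in exactly the `hchart` format of `Analysis/Asymptotics/LaplaceMethodChart.lean`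
  (`tendsto_laplaceMethod_fibred_chart`, parameter space `M := K` with the measure `ν`, `W := univ ×ˢ B`):
  `μ|_T = Θ_*(((ν ⊗ ρ)|_{K × B}) · j)`, `j(k, y) = (∫_Φ J(z, y) dκ(z)) ∕ ν(((eΦ)·S)⁻¹)` — a density depending
  on the transversal coordinate ONLY (`restrict_tube_eq_map_withDensity`, `lintegral` form
  `measure_mul_lintegral_tube_eq_fibred`, real-density form `restrict_tube_eq_map_withDensity_ofReal`).  The
  parametrisation `e` of the group window and its own density never enter: only `ν`-averages do.  PROOF =
  the averaging device: translate the window identity by `k₀ ∈ K`, integrate `dν(k₀)`, Tonelli twice (RIGHT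
  invariance of `ν` moves the translate into the orbit average, LEFT invariance evaluates the fibre mass) —
  no covering argument, no uniqueness of Haar measure, no quotient by the stabiliser.
* §4 the TOPOLOGICAL SLICE LEMMA producing the slice property from local data: `K` sequentially compact
  acting continuously, `σ` continuous at `y₀`, the stabiliser of `x₀ = σ y₀` contained in a set `S` fixing
  `σ(Y)` pointwise, and local injectivity of `Θ` near `(1, y₀)` (an inverse-function-theorem output) ⟹ the
  slice property, with `y = y'`, on a neighbourhood of `y₀` (`exists_nhds_slice_of_locallyInjective`).
* §5 finite stabilisers: a closed symmetric neighbourhood `P` of `1` whose right translates `P·s`, `s ∈ S`,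
  are pairwise disjoint (`exists_nhds_one_pairwiseDisjoint_mul_singleton`), so that
  `ν(P·S) = |S| · ν(P)` for right-invariant `ν` (`measure_mul_finset_eq_card_mul`); and measurability of tubes
  with compact data (`measurableSet_image_prod_of_isCompact`).
* §6 the same statements for a registered measurable action (`MulAction K X`, `SMulInvariantMeasure`).
* §7 `measure_mul_setLIntegral_tube_eq_of_invariant` ∕ ★ `measureReal_mul_setIntegral_tube_eq_of_invariant` — Faddeev–Popov
  localisation of an INVARIANT integrand: `ν(((eΦ)·S)⁻¹) · ∫_{tube} F dμ = ν(K) · ∫_{window} F dμ` (`lintegral` and real Bochner forms).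

WHY (the use).  This is the measure-theoretic content of the tube theorem `K ×_S B ≅ K•σ(B)` for an orbit
with finite stabiliser acting trivially on the slice [Bredon1972, Ch. II §§4–5; DearricottEtAl2014 (Searle)
Def. 1.11 and properties (1)–(7), PDF pp. 34–35], in the form consumed by the Laplace method on a
non-degenerate critical ORBIT of an invariant phase (`tendsto_laplaceMethod_fibred_chart` with `M` the
acting group): the differential topology (inverse function theorem in exponential coordinates, the chart of
`X`) is done ONCE, at one point of the orbit, and this file does the rest.  The averaging device is
Helgason's [Helgason2000, Ch. I §1, proof of Prop. 1.13 (PDF p. 114 L26: «I(f) is a positive multiple of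
dg_H») and Thm. 1.14], as in the sibling `HaarLocalChart.lean`; the insertion of an orbit average against
an invariant measure is the Faddeev–Popov manipulation of `FaddeevPopovAveraging.lean` [Creutz2022, Ch. 9
Ex. 4; MontvayMunster1994, §3.2.2 (3.238)].

HONEST SCOPE.  Pure measure theory and point-set topology; nothing about Lie groups, exponential charts,
Laplace asymptotics proper, lattice gauge theory, or the Yang–Mills mass gap (Clay), which is NOT proved;
`R4` closes only the conditional finite-`𝕋⁴` rung `BalabanLadder.UV`.

## Mathlib ∕ tree search
Mathlib: Haar measures, `SMulInvariantMeasure`, `measure_preimage_mul`, `measure_inv`,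
`lintegral_mul_right_eq_self`, `prod_restrict`, `lintegral_prod_symm`, `SeqCompactSpace.tendsto_subseq`,
`exists_closed_nhds_one_inv_eq_mul_subset` — all used; no slice ∕ tube theorem for group actions, no orbit
tubular coordinates.  Tree: `HaarLocalChart.lean` (averaging lemma for a window IN the group),
`HaarTubePushforward*.lean` (tube of a compact linear group inside a Banach algebra, left multiplication),
`FaddeevPopovAveraging.lean` (orbit averages against invariant measures) — different statements; their
lemmas are imported, nothing is re-declared.

## References
* G. E. Bredon, *Introduction to Compact Transformation Groups*, Academic Press (1972), Ch. II §4 (slices)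
  and §5 (tubes). [Bredon1972]
* C. Searle, *An introduction to isometric group actions*, in: O. Dearricott et al., *Geometry of Manifolds
  with Non-negative Sectional Curvature*, LNM 2110, Springer (2014), Def. 1.11 and properties (1)–(7)
  (PDF pp. 34–35: slices, `Ψ : G ×_{G_p} S_p → S`, `[g, p'] ↦ g p'`, product `G∕G_p × S_p` when `G_p` acts
  trivially on the slice). [DearricottEtAl2014]
* S. Helgason, *Groups and Geometric Analysis*, AMS (2000), Ch. I §1 Prop. 1.13 ∕ Thm. 1.14 (PDF pp. 113–114;
  the averaging device). [Helgason2000]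
* M. Creutz, *Quarks, Gluons and Lattices*, CUP, Ch. 9 Ex. 4 (PDF p. 44); I. Montvay, G. Münster, *Quantum
  Fields on a Lattice*, CUP (1994), §3.2.2 (3.238) p. 135 (orbit averages ∕ Faddeev–Popov). [Creutz2022]
  [MontvayMunster1994]
-/

noncomputable section

open _root_.MeasureTheory _root_.MeasureTheory.Measure Set Filter Function
open scoped ENNReal NNReal Topology Pointwise

namespace Literature.MeasureTheory.Group

/-! ## §1 Orbit averaging of a window (chart-free) -/

section Algebra

variable {K X : Type*} [Group K] {act : K → X → X}

/-- The inverse group element undoes the action. [cite: Bredon1972, Ch. II §4] -/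
theorem act_inv_act (hmul : ∀ k k' x, act (k * k') x = act k (act k' x)) (hone : ∀ x, act 1 x = x)
    (k : K) (x : X) : act k⁻¹ (act k x) = x := by
  rw [← hmul, inv_mul_cancel, hone]

/-- The action undoes the inverse group element. [cite: Bredon1972, Ch. II §4] -/
theorem act_act_inv (hmul : ∀ k k' x, act (k * k') x = act k (act k' x)) (hone : ∀ x, act 1 x = x)
    (k : K) (x : X) : act k (act k⁻¹ x) = x := by
  rw [← hmul, mul_inv_cancel, hone]

end Algebra

section Window

variable {K X : Type*} [MeasurableSpace K] [MeasurableSpace X] {act : K → X → X}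
  {ν : Measure K} {μ : Measure X}

/-- Each map of a jointly measurable family is measurable. [cite: Creutz2022, Ch. 9 Exercise 4 (PDF p. 44)] -/
theorem measurable_act_of_jointly (hact : Measurable fun p : K × X => act p.1 p.2) (k : K) :
    Measurable (act k) :=
  hact.comp (measurable_const.prodMk measurable_id)

variable [Group K]

/-- The «fibre-mass set» `{k | act k⁻¹ x ∈ A}` of a measurable window is measurable.
[cite: Bredon1972, Ch. II §4] -/
theorem measurableSet_fibre [MeasurableInv K] (hact : Measurable fun p : K × X => act p.1 p.2)
    {A : Set X} (hA : MeasurableSet A) (x : X) : MeasurableSet {k : K | act k⁻¹ x ∈ A} :=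
  (hact.comp (measurable_inv.prodMk measurable_const)) hA

/-- **Translating a window and undoing the translation inside the integral** (invariance of `μ`):
`∫_A g(act k x) dμ(x) = ∫_X 1_A(act k⁻¹ x) g(x) dμ(x)` — the integral of `g` over the translated window
`act k (A)`. [cite: Helgason2000, Ch. I §1 Prop. 1.13 ∕ Thm. 1.14 (PDF pp. 113–114)] -/
theorem setLIntegral_comp_act_eq_lintegral_indicator_mul
    (hact : Measurable fun p : K × X => act p.1 p.2)
    (hmul : ∀ k k' x, act (k * k') x = act k (act k' x)) (hone : ∀ x, act 1 x = x)
    (hpres : ∀ k, MeasurePreserving (act k) μ μ)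
    {A : Set X} (hA : MeasurableSet A) {g : X → ℝ≥0∞} (hg : Measurable g) (k : K) :
    ∫⁻ x in A, g (act k x) ∂μ = ∫⁻ x, A.indicator (1 : X → ℝ≥0∞) (act k⁻¹ x) * g x ∂μ := by
  have hactk := measurable_act_of_jointly hact
  have hFm : Measurable fun x => A.indicator (1 : X → ℝ≥0∞) (act k⁻¹ x) * g x :=
    ((measurable_one.indicator hA).comp (hactk k⁻¹)).mul hg
  rw [← (hpres k).lintegral_comp hFm, ← lintegral_indicator hA]
  refine lintegral_congr fun x => ?_
  simp only [act_inv_act hmul hone]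
  by_cases hx : x ∈ A
  · simp [Set.indicator_of_mem hx]
  · simp [Set.indicator_of_notMem hx]

/-- ★ **Orbit averaging of a window (chart-free).**  For a jointly measurable family of `μ`-preserving maps
`act k` with `act (k k') = act k ∘ act k'`, `act 1 = id`, an s-finite `ν` on `K`, a measurable window `A ⊆ X`
and a measurable `g ≥ 0`:
`∫_A (∫_K g(act k x) dν(k)) dμ(x) = ∫_X g(x) · ν{k | act k⁻¹ x ∈ A} dμ(x)`.
(Tonelli, and the invariance of `μ` under each `act k`; no invariance of `ν` is used.)
[cite: Helgason2000, Ch. I §1 Prop. 1.13 ∕ Thm. 1.14 (PDF pp. 113–114)]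
[cite: Creutz2022, Ch. 9 Exercise 4 (PDF p. 44)] -/
theorem lintegral_window_orbitAverage_eq [MeasurableInv K] [SFinite ν] [SFinite μ]
    (hact : Measurable fun p : K × X => act p.1 p.2)
    (hmul : ∀ k k' x, act (k * k') x = act k (act k' x)) (hone : ∀ x, act 1 x = x)
    (hpres : ∀ k, MeasurePreserving (act k) μ μ)
    {A : Set X} (hA : MeasurableSet A) {g : X → ℝ≥0∞} (hg : Measurable g) :
    ∫⁻ x in A, (∫⁻ k, g (act k x) ∂ν) ∂μ = ∫⁻ x, g x * ν {k : K | act k⁻¹ x ∈ A} ∂μ := by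
  -- joint measurability of the two integrands that get swapped
  have h1m : Measurable fun p : X × K => g (act p.2 p.1) := hg.comp (hact.comp measurable_swap)
  have hinvact : Measurable fun p : K × X => act p.1⁻¹ p.2 :=
    hact.comp (measurable_fst.inv.prodMk measurable_snd)
  have h2m : Measurable fun p : K × X => A.indicator (1 : X → ℝ≥0∞) (act p.1⁻¹ p.2) * g p.2 :=
    ((measurable_one.indicator hA).comp hinvact).mul (hg.comp measurable_snd)
  calc ∫⁻ x in A, (∫⁻ k, g (act k x) ∂ν) ∂μ
      = ∫⁻ k, ∫⁻ x in A, g (act k x) ∂μ ∂ν := lintegral_lintegral_swap h1m.aemeasurable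
    _ = ∫⁻ k, ∫⁻ x, A.indicator (1 : X → ℝ≥0∞) (act k⁻¹ x) * g x ∂μ ∂ν := by
        refine lintegral_congr fun k => ?_
        exact setLIntegral_comp_act_eq_lintegral_indicator_mul hact hmul hone hpres hA hg k
    _ = ∫⁻ x, ∫⁻ k, A.indicator (1 : X → ℝ≥0∞) (act k⁻¹ x) * g x ∂ν ∂μ :=
        lintegral_lintegral_swap h2m.aemeasurable
    _ = ∫⁻ x, g x * ν {k : K | act k⁻¹ x ∈ A} ∂μ := by
        refine lintegral_congr fun x => ?_
        have hkm : Measurable fun k : K => A.indicator (1 : X → ℝ≥0∞) (act k⁻¹ x) :=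
          (measurable_one.indicator hA).comp (hact.comp (measurable_inv.prodMk measurable_const))
        rw [lintegral_mul_const _ hkm, mul_comm (g x)]
        congr 1
        have hset : (fun k : K => A.indicator (1 : X → ℝ≥0∞) (act k⁻¹ x)) =
            ({k : K | act k⁻¹ x ∈ A}).indicator 1 := by
          funext k
          by_cases hk : act k⁻¹ x ∈ A
          · rw [Set.indicator_of_mem hk, Set.indicator_of_mem (show k ∈ {k : K | act k⁻¹ x ∈ A} from hk)]
            rfl
          · rw [Set.indicator_of_notMem hk,
              Set.indicator_of_notMem (show k ∉ {k : K | act k⁻¹ x ∈ A} from hk)]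
        rw [hset, lintegral_indicator_one (measurableSet_fibre hact hA x)]

end Window

/-! ## §2 The fibre mass of a product window under the slice property -/

section Slice

variable {K X Y Z : Type*} [Group K] {act : K → X → X} {σ : Y → X} {e : Z → K}
  {Θ : K × Y → X} {Θ' : Z × Y → X} {B : Set Y} {Φ : Set Z} {S : Set K}

/-- **The fibre set over a point of the tube.**  Under the slice property («`act k (σ y) = σ y'`,
`y, y' ∈ B` ⟹ `k ∈ S`») with `S` fixing `σ(B)` pointwise, for `x = act k (σ y)`, `y ∈ B`, the set of
`k₀` with `act k₀⁻¹ x` in the window `A = Θ'(Φ × B)` (`Θ'(z, y) = act (e z) (σ y)`) is the left translate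
`k · ((eΦ)·S)⁻¹`. [cite: DearricottEtAl2014, (Searle) properties (1)–(2) and (6)–(7), PDF pp. 34–35]
[cite: Bredon1972, Ch. II §4] -/
theorem fibre_set_eq_of_slice
    (hmul : ∀ k k' x, act (k * k') x = act k (act k' x)) (hone : ∀ x, act 1 x = x)
    (hΘ' : ∀ z y, Θ' (z, y) = act (e z) (σ y))
    (hslice : ∀ k : K, ∀ y ∈ B, ∀ y' ∈ B, act k (σ y) = σ y' → k ∈ S)
    (hfix : ∀ s ∈ S, ∀ y ∈ B, act s (σ y) = σ y)
    (k : K) {y : Y} (hy : y ∈ B) :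
    {k₀ : K | act k₀⁻¹ (act k (σ y)) ∈ Θ' '' (Φ ×ˢ B)} =
      (fun k₀ => k⁻¹ * k₀) ⁻¹' ((e '' Φ) * S)⁻¹ := by
  ext k₀
  rw [mem_setOf_eq, mem_preimage, Set.mem_inv, mul_inv_rev, inv_inv]
  constructor
  · rintro ⟨⟨z, y'⟩, ⟨hz, hy'⟩, hzy⟩
    rw [hΘ', ← hmul] at hzy
    -- `act ((e z)⁻¹ * (k₀⁻¹ * k)) (σ y) = σ y'`
    have hkey : act ((e z)⁻¹ * (k₀⁻¹ * k)) (σ y) = σ y' := by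
      rw [hmul, ← hzy, act_inv_act hmul hone]
    have hS : (e z)⁻¹ * (k₀⁻¹ * k) ∈ S := hslice _ y hy y' hy' hkey
    refine Set.mem_mul.2 ⟨e z, mem_image_of_mem e hz, (e z)⁻¹ * (k₀⁻¹ * k), hS, ?_⟩
    rw [mul_inv_cancel_left]
  · intro hmem
    obtain ⟨p, hp, s, hs, hps⟩ := Set.mem_mul.1 hmem
    obtain ⟨z, hz, rfl⟩ := hp
    refine ⟨(z, y), ⟨hz, hy⟩, ?_⟩
    rw [hΘ', ← hmul, ← hps, hmul, hfix s hs y hy]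

/-- **Off the tube the fibre set is empty**: the window `A ⊆ T = Θ(K × B)` and the tube is invariant, so
`act k₀⁻¹ x ∈ A` forces `x ∈ T`. [cite: DearricottEtAl2014, (Searle) property (3), PDF p. 35]
[cite: Bredon1972, Ch. II §4] -/
theorem fibre_set_eq_empty_of_not_mem_tube
    (hmul : ∀ k k' x, act (k * k') x = act k (act k' x)) (hone : ∀ x, act 1 x = x)
    (hΘ : ∀ k y, Θ (k, y) = act k (σ y)) (hΘ' : ∀ z y, Θ' (z, y) = act (e z) (σ y))
    {x : X} (hx : x ∉ Θ '' (univ ×ˢ B)) :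
    {k₀ : K | act k₀⁻¹ x ∈ Θ' '' (Φ ×ˢ B)} = ∅ := by
  ext k₀
  simp only [mem_setOf_eq, mem_empty_iff_false, iff_false, mem_image, mem_prod, Prod.exists, not_exists,
    not_and, and_imp]
  intro z y _ hy hzy
  apply hx
  refine ⟨(k₀ * e z, y), ⟨mem_univ _, hy⟩, ?_⟩
  rw [hΘ, hmul, ← hΘ', hzy, act_act_inv hmul hone]

variable [MeasurableSpace K] {ν : Measure K}

/-- The fibre mass is an invariant function of `x` when `ν` is left-invariant:
`ν{k | act k⁻¹ (act k' x) ∈ A} = ν{k | act k⁻¹ x ∈ A}`. [cite: Bredon1972, Ch. II §4] -/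
theorem measure_fibre_act_eq [MeasurableMul K] [IsMulLeftInvariant ν]
    (hmul : ∀ k k' x, act (k * k') x = act k (act k' x)) {A : Set X} (k' : K) (x : X) :
    ν {k : K | act k⁻¹ (act k' x) ∈ A} = ν {k : K | act k⁻¹ x ∈ A} := by
  have hset : {k : K | act k⁻¹ (act k' x) ∈ A} = (fun k => k'⁻¹ * k) ⁻¹' {k : K | act k⁻¹ x ∈ A} := by
    ext k
    simp only [mem_setOf_eq, mem_preimage, mul_inv_rev, inv_inv, hmul]
  rw [hset, measure_preimage_mul]

/-- Orbit averages do not see a group translate of the base point: for right-invariant `ν`,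
`∫ g(act k (act k' x)) dν(k) = ∫ g(act k x) dν(k)`. [cite: Creutz2022, Ch. 9 Exercise 4 (PDF p. 44)] -/
theorem lintegral_comp_act_act_eq [MeasurableMul K] [IsMulRightInvariant ν]
    (hmul : ∀ k k' x, act (k * k') x = act k (act k' x)) (g : X → ℝ≥0∞) (k' : K) (x : X) :
    ∫⁻ k, g (act k (act k' x)) ∂ν = ∫⁻ k, g (act k x) ∂ν := by
  have h := lintegral_mul_right_eq_self (μ := ν) (fun k => g (act k x)) k'
  simpa only [hmul] using h

/-- **The fibre mass of a product window**: on the tube it is the constant `ν(((eΦ)·S)⁻¹)` (left invariance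
of `ν`), off the tube it is `0`. [cite: DearricottEtAl2014, (Searle) properties (1)–(7), PDF pp. 34–35]
[cite: Helgason2000, Ch. I §1 Prop. 1.13 ∕ Thm. 1.14 (PDF pp. 113–114)] -/
theorem measure_fibre_eq_indicator [MeasurableMul K] [IsMulLeftInvariant ν]
    (hmul : ∀ k k' x, act (k * k') x = act k (act k' x)) (hone : ∀ x, act 1 x = x)
    (hΘ : ∀ k y, Θ (k, y) = act k (σ y)) (hΘ' : ∀ z y, Θ' (z, y) = act (e z) (σ y))
    (hslice : ∀ k : K, ∀ y ∈ B, ∀ y' ∈ B, act k (σ y) = σ y' → k ∈ S)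
    (hfix : ∀ s ∈ S, ∀ y ∈ B, act s (σ y) = σ y) (x : X) :
    ν {k₀ : K | act k₀⁻¹ x ∈ Θ' '' (Φ ×ˢ B)} =
      (Θ '' (univ ×ˢ B)).indicator (fun _ => ν (((e '' Φ) * S)⁻¹)) x := by
  by_cases hx : x ∈ Θ '' (univ ×ˢ B)
  · rw [Set.indicator_of_mem hx]
    obtain ⟨⟨k, y⟩, ⟨-, hy⟩, rfl⟩ := hx
    rw [hΘ, fibre_set_eq_of_slice hmul hone hΘ' hslice hfix k hy, measure_preimage_mul]
  · rw [Set.indicator_of_notMem hx, fibre_set_eq_empty_of_not_mem_tube hmul hone hΘ hΘ' hx, measure_empty]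

/-- ★ **The tube integral as a window integral of the orbit average.**  Under the slice property,
`ν(((eΦ)·S)⁻¹) · ∫_T g dμ = ∫_A (∫_K g(act k x) dν(k)) dμ(x)` for the tube `T = Θ(K × B)` and the window
`A = Θ'(Φ × B)`, every measurable `g ≥ 0`.
[cite: Helgason2000, Ch. I §1 Prop. 1.13 ∕ Thm. 1.14 (PDF pp. 113–114)]
[cite: DearricottEtAl2014, (Searle) properties (1)–(7), PDF pp. 34–35] -/
theorem measure_mul_lintegral_tube_eq_window_orbitAverage
    [MeasurableMul K] [MeasurableInv K] [IsMulLeftInvariant ν] [SFinite ν]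
    [MeasurableSpace X] {μ : Measure X} [SFinite μ]
    (hact : Measurable fun p : K × X => act p.1 p.2)
    (hmul : ∀ k k' x, act (k * k') x = act k (act k' x)) (hone : ∀ x, act 1 x = x)
    (hpres : ∀ k, MeasurePreserving (act k) μ μ)
    (hΘ : ∀ k y, Θ (k, y) = act k (σ y)) (hΘ' : ∀ z y, Θ' (z, y) = act (e z) (σ y))
    (hslice : ∀ k : K, ∀ y ∈ B, ∀ y' ∈ B, act k (σ y) = σ y' → k ∈ S)
    (hfix : ∀ s ∈ S, ∀ y ∈ B, act s (σ y) = σ y)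
    (hT : MeasurableSet (Θ '' (univ ×ˢ B))) (hA : MeasurableSet (Θ' '' (Φ ×ˢ B)))
    {g : X → ℝ≥0∞} (hg : Measurable g) :
    ν (((e '' Φ) * S)⁻¹) * ∫⁻ x in Θ '' (univ ×ˢ B), g x ∂μ =
      ∫⁻ x in Θ' '' (Φ ×ˢ B), (∫⁻ k, g (act k x) ∂ν) ∂μ := by
  rw [lintegral_window_orbitAverage_eq hact hmul hone hpres hA hg]
  simp_rw [measure_fibre_eq_indicator hmul hone hΘ hΘ' hslice hfix]
  rw [← lintegral_indicator hT, ← lintegral_const_mul _ (hg.indicator hT)]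
  refine lintegral_congr fun x => ?_
  by_cases hx : x ∈ Θ '' (univ ×ˢ B)
  · rw [Set.indicator_of_mem hx, Set.indicator_of_mem hx, mul_comm]
  · rw [Set.indicator_of_notMem hx, Set.indicator_of_notMem hx, mul_zero, mul_zero]

end Slice

/-! ## §3 Globalisation of a local product chart -/

section Chart

variable {K X Y Z : Type*} [Group K] [MeasurableSpace K] [MeasurableSpace X] [MeasurableSpace Y]
  [MeasurableSpace Z] {act : K → X → X} {σ : Y → X} {e : Z → K}
  {Θ : K × Y → X} {Θ' : Z × Y → X} {B : Set Y} {Φ : Set Z} {S : Set K}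
  {ν : Measure K} {μ : Measure X} {ρ : Measure Y} {κ : Measure Z}

/-- **Reading an integral over the window in the local product coordinates**: the local chart identity
`μ|_A = Θ'_*(((κ ⊗ ρ)|_{Φ×B}) · J)` says `∫_A F dμ = ∫_{Φ×B} J · F∘Θ' d(κ ⊗ ρ)` for measurable `F ≥ 0`.
[cite: Helgason2000, Ch. I §1 Thm. 1.14 (13) (PDF p. 114)] -/
theorem setLIntegral_window_eq_of_localChart {J : Z × Y → ℝ≥0∞} (hΘ'm : Measurable Θ') (hJ : Measurable J)
    (hloc : μ.restrict (Θ' '' (Φ ×ˢ B)) =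
      (((κ.prod ρ).restrict (Φ ×ˢ B)).withDensity J).map Θ')
    {F : X → ℝ≥0∞} (hF : Measurable F) :
    ∫⁻ x in Θ' '' (Φ ×ˢ B), F x ∂μ = ∫⁻ w in Φ ×ˢ B, J w * F (Θ' w) ∂(κ.prod ρ) := by
  have hFΘ : Measurable fun w => F (Θ' w) := hF.comp hΘ'm
  rw [hloc, lintegral_map hF hΘ'm, lintegral_withDensity_eq_lintegral_mul _ hJ hFΘ]
  rfl

/-- ★★ **Globalisation of a local product chart, `lintegral` form.**  Let `act` be a jointly measurable
family of `μ`-preserving maps of `X` indexed by a group `K` (`act (kk') = act k ∘ act k'`, `act 1 = id`),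
`ν` a left- and right-invariant s-finite measure on `K`, `σ : Y → X` a transversal with window `B`,
`Θ(k, y) = act k (σ y)`, and `Θ'(z, y) = act (e z) (σ y)` a parametrisation of a window `A = Θ'(Φ × B)` of
the tube `T = Θ(K × B)` (both measurable) satisfying the SLICE property with a set `S` fixing `σ(B)`.  If
LOCALLY `μ|_A = Θ'_*(((κ ⊗ ρ)|_{Φ×B}) · J)`, then for every measurable `g ≥ 0`
`ν(((eΦ)·S)⁻¹) · ∫_T g dμ = ∫_{K×B} g(Θ(k, y)) · (∫_Φ J(z, y) dκ(z)) d(ν ⊗ ρ)(k, y)`.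
[cite: Helgason2000, Ch. I §1 Prop. 1.13 ∕ Thm. 1.14 (PDF pp. 113–114)]
[cite: DearricottEtAl2014, (Searle) Def. 1.11 and properties (1)–(7), PDF pp. 34–35]
[cite: Bredon1972, Ch. II §§4–5] -/
theorem measure_mul_lintegral_tube_eq_fibred
    [MeasurableMul K] [MeasurableInv K] [IsMulLeftInvariant ν] [IsMulRightInvariant ν]
    [SFinite ν] [SFinite μ] [SFinite ρ] [SFinite κ]
    (hact : Measurable fun p : K × X => act p.1 p.2)
    (hmul : ∀ k k' x, act (k * k') x = act k (act k' x)) (hone : ∀ x, act 1 x = x)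
    (hpres : ∀ k, MeasurePreserving (act k) μ μ) (hσ : Measurable σ)
    (hΘ : ∀ k y, Θ (k, y) = act k (σ y)) (hΘ' : ∀ z y, Θ' (z, y) = act (e z) (σ y)) (hΘ'm : Measurable Θ')
    (hslice : ∀ k : K, ∀ y ∈ B, ∀ y' ∈ B, act k (σ y) = σ y' → k ∈ S)
    (hfix : ∀ s ∈ S, ∀ y ∈ B, act s (σ y) = σ y)
    (hT : MeasurableSet (Θ '' (univ ×ˢ B))) (hA : MeasurableSet (Θ' '' (Φ ×ˢ B)))
    {J : Z × Y → ℝ≥0∞} (hJ : Measurable J)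
    (hloc : μ.restrict (Θ' '' (Φ ×ˢ B)) =
      (((κ.prod ρ).restrict (Φ ×ˢ B)).withDensity J).map Θ')
    {g : X → ℝ≥0∞} (hg : Measurable g) :
    ν (((e '' Φ) * S)⁻¹) * ∫⁻ x in Θ '' (univ ×ˢ B), g x ∂μ =
      ∫⁻ z in univ ×ˢ B, g (Θ z) * (∫⁻ p in Φ, J (p, z.2) ∂κ) ∂(ν.prod ρ) := by
  -- the orbit average `ḡ` and its transversal trace `y ↦ ḡ(σ y)`
  have hgbar : Measurable fun x => ∫⁻ k, g (act k x) ∂ν := measurable_lintegral_act (ν := ν) hact hg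
  have hGm : Measurable fun y => ∫⁻ k, g (act k (σ y)) ∂ν := hgbar.comp hσ
  have hJbar : Measurable fun y => ∫⁻ p in Φ, J (p, y) ∂κ := hJ.lintegral_prod_left'
  -- step 1: tube integral = window integral of the orbit average (slice property, left invariance);
  -- step 2: read the window integral in the local product coordinates
  rw [measure_mul_lintegral_tube_eq_window_orbitAverage hact hmul hone hpres hΘ hΘ' hslice hfix hT hA hg,
    setLIntegral_window_eq_of_localChart hΘ'm hJ hloc hgbar]
  -- step 3: the orbit average forgets the group coordinate (right invariance); integrate it out
  have hΘfun : Θ = fun z : K × Y => act z.1 (σ z.2) := by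
    funext z
    obtain ⟨k, y⟩ := z
    exact hΘ k y
  have hinner : ∀ w : Z × Y, (∫⁻ k, g (act k (Θ' w)) ∂ν) = ∫⁻ k, g (act k (σ w.2)) ∂ν := by
    rintro ⟨z, y⟩
    rw [hΘ', lintegral_comp_act_act_eq hmul]
  simp only [hinner, hΘfun]
  have hf1 : Measurable fun w : Z × Y => J w * ∫⁻ k, g (act k (σ w.2)) ∂ν :=
    hJ.mul (hGm.comp measurable_snd)
  have hf2 : Measurable fun z : K × Y => g (act z.1 (σ z.2)) * ∫⁻ p in Φ, J (p, z.2) ∂κ :=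
    (hg.comp (hact.comp (measurable_fst.prodMk (hσ.comp measurable_snd)))).mul
      (hJbar.comp measurable_snd)
  rw [← Measure.prod_restrict, ← Measure.prod_restrict, Measure.restrict_univ,
    lintegral_prod_symm' _ hf1, lintegral_prod_symm' _ hf2]
  refine lintegral_congr fun y => ?_
  have hm1 : Measurable fun p : Z => J (p, y) := hJ.comp (measurable_id.prodMk measurable_const)
  have hm2 : Measurable fun k : K => g (act k (σ y)) :=
    hg.comp (hact.comp (measurable_id.prodMk measurable_const))
  simp only []
  rw [lintegral_mul_const _ hm1, lintegral_mul_const _ hm2, mul_comm]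

/-- ★★ **Globalisation of a local product chart: the GLOBAL FIBRED CHART IDENTITY** in the `hchart` format
of `Analysis/Asymptotics/LaplaceMethodChart.lean` (`tendsto_laplaceMethod_fibred_chart`, parameter space
the acting group `K` with its measure `ν`, `W = univ ×ˢ B`):
`μ|_{Θ(K×B)} = Θ_*(((ν ⊗ ρ)|_{K×B}) · j)`, `j(k, y) = (∫_Φ J(z, y) dκ(z)) ∕ ν(((eΦ)·S)⁻¹)` — under the local
identity `μ|_{Θ'(Φ×B)} = Θ'_*(((κ ⊗ ρ)|_{Φ×B}) · J)`, the slice property, and `0 < ν(((eΦ)·S)⁻¹) < ∞`.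
[cite: Helgason2000, Ch. I §1 Prop. 1.13 ∕ Thm. 1.14 (PDF pp. 113–114)]
[cite: DearricottEtAl2014, (Searle) Def. 1.11 and properties (1)–(7), PDF pp. 34–35]
[cite: Bredon1972, Ch. II §§4–5] -/
theorem restrict_tube_eq_map_withDensity
    [MeasurableMul K] [MeasurableInv K] [IsMulLeftInvariant ν] [IsMulRightInvariant ν]
    [SFinite ν] [SFinite μ] [SFinite ρ] [SFinite κ]
    (hact : Measurable fun p : K × X => act p.1 p.2)
    (hmul : ∀ k k' x, act (k * k') x = act k (act k' x)) (hone : ∀ x, act 1 x = x)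
    (hpres : ∀ k, MeasurePreserving (act k) μ μ) (hσ : Measurable σ)
    (hΘ : ∀ k y, Θ (k, y) = act k (σ y)) (hΘm : Measurable Θ)
    (hΘ' : ∀ z y, Θ' (z, y) = act (e z) (σ y)) (hΘ'm : Measurable Θ')
    (hslice : ∀ k : K, ∀ y ∈ B, ∀ y' ∈ B, act k (σ y) = σ y' → k ∈ S)
    (hfix : ∀ s ∈ S, ∀ y ∈ B, act s (σ y) = σ y)
    (hT : MeasurableSet (Θ '' (univ ×ˢ B))) (hA : MeasurableSet (Θ' '' (Φ ×ˢ B)))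
    {J : Z × Y → ℝ≥0∞} (hJ : Measurable J)
    (hloc : μ.restrict (Θ' '' (Φ ×ˢ B)) =
      (((κ.prod ρ).restrict (Φ ×ˢ B)).withDensity J).map Θ')
    (hc0 : ν (((e '' Φ) * S)⁻¹) ≠ 0) (hctop : ν (((e '' Φ) * S)⁻¹) ≠ ∞) :
    μ.restrict (Θ '' (univ ×ˢ B)) =
      (((ν.prod ρ).restrict (univ ×ˢ B)).withDensity
        fun z => (∫⁻ p in Φ, J (p, z.2) ∂κ) / ν (((e '' Φ) * S)⁻¹)).map Θ := by
  set c : ℝ≥0∞ := ν (((e '' Φ) * S)⁻¹) with hc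
  have hJbar : Measurable fun y => ∫⁻ p in Φ, J (p, y) ∂κ := hJ.lintegral_prod_left'
  ext s hs
  have hind1 : Measurable (s.indicator (1 : X → ℝ≥0∞)) := measurable_one.indicator hs
  have key := measure_mul_lintegral_tube_eq_fibred (ν := ν) hact hmul hone hpres hσ hΘ hΘ' hΘ'm hslice
    hfix hT hA hJ hloc hind1
  rw [lintegral_indicator_one hs, ← hc] at key
  rw [Measure.map_apply hΘm hs, withDensity_apply _ (hΘm hs), ← lintegral_indicator (hΘm hs)]
  have hind : ∀ z : K × Y, (Θ ⁻¹' s).indicator (fun z => (∫⁻ p in Φ, J (p, z.2) ∂κ) / c) z =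
      (s.indicator (1 : X → ℝ≥0∞) (Θ z) * ∫⁻ p in Φ, J (p, z.2) ∂κ) * c⁻¹ := by
    intro z
    by_cases hz : Θ z ∈ s
    · rw [Set.indicator_of_mem (show z ∈ Θ ⁻¹' s from hz), Set.indicator_of_mem hz, Pi.one_apply, one_mul,
        div_eq_mul_inv]
    · rw [Set.indicator_of_notMem (show z ∉ Θ ⁻¹' s from hz), Set.indicator_of_notMem hz, zero_mul,
        zero_mul]
  simp_rw [hind]
  have hFm : Measurable fun z : K × Y => s.indicator (1 : X → ℝ≥0∞) (Θ z) * ∫⁻ p in Φ, J (p, z.2) ∂κ :=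
    (hind1.comp hΘm).mul (hJbar.comp measurable_snd)
  rw [lintegral_mul_const _ hFm, ← key, mul_comm c, mul_assoc, ENNReal.mul_inv_cancel hc0 hctop, mul_one]

/-- ★★ **The global fibred chart identity with a REAL density** (`ENNReal.ofReal`, literally the `hchart`
hypothesis of `tendsto_laplaceMethod_fibred_chart`): under the local identity with density
`ENNReal.ofReal ∘ J`, `J ≥ 0` on `Φ × B` and `z ↦ J(z, y)` integrable on `Φ` for `y ∈ B`,
`μ|_{Θ(K×B)} = Θ_*(((ν ⊗ ρ)|_{K×B}) · ofReal j)`, `j(k, y) = (∫_Φ J(z, y) dκ(z)) ∕ ν(((eΦ)·S)⁻¹).toReal`.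
[cite: Helgason2000, Ch. I §1 Prop. 1.13 ∕ Thm. 1.14 (PDF pp. 113–114)]
[cite: DearricottEtAl2014, (Searle) Def. 1.11 and properties (1)–(7), PDF pp. 34–35]
[cite: Bredon1972, Ch. II §§4–5] -/
theorem restrict_tube_eq_map_withDensity_ofReal
    [MeasurableMul K] [MeasurableInv K] [IsMulLeftInvariant ν] [IsMulRightInvariant ν]
    [SFinite ν] [SFinite μ] [SFinite ρ] [SFinite κ]
    (hact : Measurable fun p : K × X => act p.1 p.2)
    (hmul : ∀ k k' x, act (k * k') x = act k (act k' x)) (hone : ∀ x, act 1 x = x)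
    (hpres : ∀ k, MeasurePreserving (act k) μ μ) (hσ : Measurable σ)
    (hΘ : ∀ k y, Θ (k, y) = act k (σ y)) (hΘm : Measurable Θ)
    (hΘ' : ∀ z y, Θ' (z, y) = act (e z) (σ y)) (hΘ'm : Measurable Θ')
    (hslice : ∀ k : K, ∀ y ∈ B, ∀ y' ∈ B, act k (σ y) = σ y' → k ∈ S)
    (hfix : ∀ s ∈ S, ∀ y ∈ B, act s (σ y) = σ y)
    (hT : MeasurableSet (Θ '' (univ ×ˢ B))) (hA : MeasurableSet (Θ' '' (Φ ×ˢ B)))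
    (hB : MeasurableSet B) (hΦ : MeasurableSet Φ)
    {J : Z × Y → ℝ} (hJm : Measurable J) (hJ0 : ∀ z ∈ Φ, ∀ y ∈ B, 0 ≤ J (z, y))
    (hJint : ∀ y ∈ B, IntegrableOn (fun z => J (z, y)) Φ κ)
    (hloc : μ.restrict (Θ' '' (Φ ×ˢ B)) =
      (((κ.prod ρ).restrict (Φ ×ˢ B)).withDensity fun w => ENNReal.ofReal (J w)).map Θ')
    (hc0 : ν (((e '' Φ) * S)⁻¹) ≠ 0) (hctop : ν (((e '' Φ) * S)⁻¹) ≠ ∞) :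
    μ.restrict (Θ '' (univ ×ˢ B)) =
      (((ν.prod ρ).restrict (univ ×ˢ B)).withDensity fun z =>
        ENNReal.ofReal ((∫ p in Φ, J (p, z.2) ∂κ) / (ν (((e '' Φ) * S)⁻¹)).toReal)).map Θ := by
  rw [restrict_tube_eq_map_withDensity hact hmul hone hpres hσ hΘ hΘm hΘ' hΘ'm hslice hfix hT hA
    hJm.ennreal_ofReal hloc hc0 hctop]
  congr 1
  refine withDensity_congr_ae ?_
  rw [← Measure.prod_restrict, Measure.restrict_univ]
  have hae : ∀ᵐ z : K × Y ∂ν.prod (ρ.restrict B), z.2 ∈ B := by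
    rw [ae_iff]
    have hset : {z : K × Y | ¬z.2 ∈ B} = (univ : Set K) ×ˢ Bᶜ := by
      ext z
      simp only [mem_setOf_eq, mem_prod, mem_univ, true_and, mem_compl_iff]
    rw [hset, Measure.prod_prod, Measure.restrict_apply hB.compl, compl_inter_self, measure_empty,
      mul_zero]
  have hcpos : 0 < (ν (((e '' Φ) * S)⁻¹)).toReal := ENNReal.toReal_pos hc0 hctop
  filter_upwards [hae] with z hz
  rw [ENNReal.ofReal_div_of_pos hcpos, ENNReal.ofReal_toReal hctop,
    ofReal_integral_eq_lintegral_ofReal (hJint z.2 hz)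
      ((ae_restrict_mem hΦ).mono fun p hp => hJ0 p hp z.2 hz)]

end Chart

/-! ## §4 The topological slice lemma -/

section TopologicalSlice

variable {K X Y : Type*} [Group K] [TopologicalSpace K] [SeqCompactSpace K] [ContinuousMul K]
  [TopologicalSpace X] [T2Space X] [TopologicalSpace Y] [FirstCountableTopology Y]
  {act : K → X → X} {σ : Y → X} {S : Set K} {y₀ : Y}

/-- ★ **The topological slice lemma.**  Let a sequentially compact group `K` act on a Hausdorff space `X`
by a jointly continuous family `act` (`act (kk') = act k ∘ act k'`, `act 1 = id`), `σ : Y → X` continuous at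
`y₀` (`Y` first countable), the stabiliser of `x₀ = σ y₀` contained in a set `S` that fixes `σ(Y)` pointwise,
and suppose `Θ(k, y) = act k (σ y)` is injective near `(1, y₀)` in the sense
«`act k (σ y) = σ y'`, `k ∈ U`, `y, y' ∈ V` ⟹ `k = 1 ∧ y = y'`» for neighbourhoods `U ∋ 1`, `V ∋ y₀` (the
output of the inverse function theorem in coordinates).  Then on some neighbourhood `W` of `y₀` the SLICE
PROPERTY holds: `act k (σ y) = σ y'`, `y, y' ∈ W` ⟹ `k ∈ S ∧ y = y'`.  (By contradiction: offending `kₙ`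
with `yₙ, yₙ' → y₀` have a convergent subsequence `kₙ → s`; the limit fixes `x₀`, so `s ∈ S`, and
`s⁻¹kₙ → 1` offends local injectivity.) [cite: Bredon1972, Ch. II §§4–5]
[cite: DearricottEtAl2014, (Searle) Def. 1.11 and property (1), PDF pp. 34–35] -/
theorem exists_nhds_slice_of_locallyInjective
    (hcont : Continuous fun p : K × X => act p.1 p.2)
    (hmul : ∀ k k' x, act (k * k') x = act k (act k' x)) (hone : ∀ x, act 1 x = x)
    (hσ : ContinuousAt σ y₀)
    (hstab : ∀ k : K, act k (σ y₀) = σ y₀ → k ∈ S) (hfix : ∀ s ∈ S, ∀ y, act s (σ y) = σ y)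
    {U : Set K} (hU : U ∈ 𝓝 (1 : K)) {V : Set Y} (hV : V ∈ 𝓝 y₀)
    (hinj : ∀ k ∈ U, ∀ y ∈ V, ∀ y' ∈ V, act k (σ y) = σ y' → k = 1 ∧ y = y') :
    ∃ W ∈ 𝓝 y₀, ∀ k : K, ∀ y ∈ W, ∀ y' ∈ W, act k (σ y) = σ y' → k ∈ S ∧ y = y' := by
  by_contra hcon
  push Not at hcon
  obtain ⟨b, hb⟩ := (𝓝 y₀).exists_antitone_basis
  choose k y hy y' hy' heq hne using fun n : ℕ => hcon (b n) (hb.mem n)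
  have hyt : Tendsto y atTop (𝓝 y₀) := hb.tendsto hy
  have hy't : Tendsto y' atTop (𝓝 y₀) := hb.tendsto hy'
  -- a convergent subsequence of the offending group elements
  obtain ⟨s, φ, hφ, hks⟩ := SeqCompactSpace.tendsto_subseq k
  -- its limit fixes `x₀ = σ y₀`
  have hlim1 : Tendsto (fun n => act (k (φ n)) (σ (y (φ n)))) atTop (𝓝 (act s (σ y₀))) := by
    have h2 : Tendsto (fun n => (k (φ n), σ (y (φ n)))) atTop (𝓝 (s, σ y₀)) :=
      hks.prodMk_nhds (hσ.tendsto.comp (hyt.comp hφ.tendsto_atTop))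
    exact (hcont.tendsto (s, σ y₀)).comp h2
  have hlim2 : Tendsto (fun n => act (k (φ n)) (σ (y (φ n)))) atTop (𝓝 (σ y₀)) := by
    have : (fun n => act (k (φ n)) (σ (y (φ n)))) = fun n => σ (y' (φ n)) := funext fun n => heq (φ n)
    rw [this]
    exact hσ.tendsto.comp (hy't.comp hφ.tendsto_atTop)
  have hsS : s ∈ S := hstab s (tendsto_nhds_unique hlim1 hlim2)
  -- `s⁻¹ k_{φ n} → 1`, eventually in `U`; `y_{φ n}, y'_{φ n}` eventually in `V`
  have hks' : Tendsto (fun n => s⁻¹ * k (φ n)) atTop (𝓝 1) := by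
    have h := ((continuous_const_mul s⁻¹).tendsto s).comp hks
    simpa only [Function.comp_def, inv_mul_cancel] using h
  have hevU : ∀ᶠ n in atTop, s⁻¹ * k (φ n) ∈ U := hks'.eventually_mem hU
  have hevV : ∀ᶠ n in atTop, y (φ n) ∈ V := (hyt.comp hφ.tendsto_atTop).eventually_mem hV
  have hevV' : ∀ᶠ n in atTop, y' (φ n) ∈ V := (hy't.comp hφ.tendsto_atTop).eventually_mem hV
  obtain ⟨n, hnU, hnV, hnV'⟩ := (hevU.and (hevV.and hevV')).exists
  have heq' : act (s⁻¹ * k (φ n)) (σ (y (φ n))) = σ (y' (φ n)) := by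
    rw [hmul, heq (φ n)]
    -- `act s⁻¹ (σ y') = σ y'` because `s` fixes `σ y'`
    conv_lhs => rw [← hfix s hsS (y' (φ n))]
    rw [act_inv_act hmul hone]
  obtain ⟨h1, h2⟩ := hinj _ hnU _ hnV _ hnV' heq'
  have hkS : k (φ n) ∈ S := by
    have : k (φ n) = s := by
      rw [← mul_inv_cancel_left s (k (φ n)), h1, mul_one]
    rw [this]
    exact hsS
  exact hne (φ n) hkS h2

end TopologicalSlice

/-! ## §5 Finite stabilisers: disjoint translates; measurability of tubes -/

section Stabiliser

variable {K : Type*} [Group K] [TopologicalSpace K] [IsTopologicalGroup K] [T1Space K]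

/-- **Separating the translates of a finite set.**  For a finite `S ⊆ K` there is a closed symmetric
neighbourhood `P` of `1` whose right translates `P·s`, `s ∈ S`, are pairwise disjoint (`P·P` avoids the
finite set `{s s'⁻¹ : s ≠ s'}`). [cite: Bredon1972, Ch. II §5] -/
theorem exists_nhds_one_pairwiseDisjoint_mul_singleton {S : Set K} (hS : S.Finite) :
    ∃ P ∈ 𝓝 (1 : K), IsClosed P ∧ P⁻¹ = P ∧ S.PairwiseDisjoint fun s => P * {s} := by
  classical
  -- the finite set of quotients `s * s'⁻¹` with `s ≠ s'` misses `1`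
  set D : Set K := (fun q : K × K => q.1 * q.2⁻¹) '' ((S ×ˢ S) \ Set.diagonal K) with hD
  have hDfin : D.Finite := ((hS.prod hS).subset fun q hq => hq.1).image _
  have h1D : (1 : K) ∉ D := by
    rintro ⟨⟨s, s'⟩, ⟨-, hne⟩, h1⟩
    apply hne
    simp only [Set.mem_diagonal_iff]
    exact mul_inv_eq_one.1 h1
  have hO : Dᶜ ∈ 𝓝 (1 : K) := hDfin.isClosed.isOpen_compl.mem_nhds h1D
  obtain ⟨P, hP1, hPcl, hPsymm, hPP⟩ := exists_closed_nhds_one_inv_eq_mul_subset hO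
  refine ⟨P, hP1, hPcl, hPsymm, ?_⟩
  intro s hs s' hs' hne
  change Disjoint (P * {s}) (P * {s'})
  rw [Set.disjoint_left]
  rintro x ⟨p, hp, t, ht, rfl⟩ ⟨p', hp', t', ht', hx⟩
  rw [Set.mem_singleton_iff] at ht ht'
  rw [ht, ht'] at hx
  -- `p * s = p' * s'` gives `s * s'⁻¹ = p⁻¹ * p' ∈ P⁻¹ P = P P ⊆ Dᶜ`
  have hq : s * s'⁻¹ = p⁻¹ * p' := by
    rw [eq_inv_mul_iff_mul_eq, ← mul_assoc, mul_inv_eq_iff_eq_mul]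
    exact hx.symm
  have hmem : p⁻¹ * p' ∈ P * P := Set.mul_mem_mul (by rw [← hPsymm]; exact Set.inv_mem_inv.2 hp) hp'
  have hnot : s * s'⁻¹ ∈ D := ⟨(s, s'), ⟨⟨hs, hs'⟩, by simpa [Set.mem_diagonal_iff] using hne⟩, rfl⟩
  exact hPP hmem (hq ▸ hnot)

end Stabiliser

section Counting

variable {K : Type*} [Group K] [MeasurableSpace K] [MeasurableMul K] (ν : Measure K)
  [IsMulRightInvariant ν]

/-- **Counting the translates**: if the right translates `P·s`, `s ∈ S` (a finite set), of a measurable `P`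
are pairwise disjoint, then `ν(P·S) = |S| · ν(P)` for a right-invariant `ν`. [cite: Bredon1972, Ch. II §5]
[cite: Helgason2000, Ch. I §1 Thm. 1.14 (PDF p. 114)] -/
theorem measure_mul_finset_eq_card_mul {P : Set K} (hP : MeasurableSet P) (S : Finset K)
    (hdisj : (S : Set K).PairwiseDisjoint fun s => P * {s}) :
    ν (P * (S : Set K)) = S.card * ν P := by
  classical
  have hunion : P * (S : Set K) = ⋃ s ∈ S, P * {s} := by
    ext x
    simp only [Set.mem_mul, Finset.mem_coe, Set.mem_iUnion, Set.mem_singleton_iff, exists_prop,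
      exists_eq_left]
    constructor
    · rintro ⟨p, hp, s, hs, rfl⟩
      exact ⟨s, hs, p, hp, rfl⟩
    · rintro ⟨s, hs, p, hp, rfl⟩
      exact ⟨p, hp, s, hs, rfl⟩
  have htrans : ∀ s : K, P * {s} = (fun x => x * s⁻¹) ⁻¹' P := by
    intro s
    ext x
    simp only [Set.mem_mul, Set.mem_singleton_iff, exists_eq_left, mem_preimage]
    constructor
    · rintro ⟨p, hp, rfl⟩
      simpa using hp
    · intro hx
      exact ⟨x * s⁻¹, hx, by simp⟩
  have hmeas : ∀ s ∈ S, MeasurableSet (P * {s}) := fun s _ => by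
    rw [htrans]
    exact (measurable_mul_const s⁻¹) hP
  rw [hunion, measure_biUnion_finset hdisj hmeas]
  have hval : ∀ s ∈ S, ν (P * {s}) = ν P := fun s _ => by
    rw [htrans, measure_preimage_mul_right]
  rw [Finset.sum_congr rfl hval, Finset.sum_const, nsmul_eq_mul]

end Counting

section Measurability

variable {K X Y : Type*} [TopologicalSpace K] [TopologicalSpace X] [T2Space X] [MeasurableSpace X]
  [OpensMeasurableSpace X] [TopologicalSpace Y]

/-- **Tubes with compact data are measurable**: the image of `P ×ˢ B` under a continuous `Θ` is compact,
hence closed, hence Borel, when `P` and `B` are compact (`P = univ` for a compact group gives the whole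
tube). [cite: Bredon1972, Ch. II §5] -/
theorem measurableSet_image_prod_of_isCompact {Θ : K × Y → X} (hΘ : Continuous Θ) {P : Set K}
    {B : Set Y} (hP : IsCompact P) (hB : IsCompact B) : MeasurableSet (Θ '' (P ×ˢ B)) :=
  ((hP.prod hB).image hΘ).isClosed.measurableSet

end Measurability

/-! ## §6 The same for a registered measurable action -/

section Action

variable {K X Y Z : Type*} [Group K] [MulAction K X] [MeasurableSpace K] [MeasurableSpace X]
  [MeasurableSpace Y] [MeasurableSpace Z] [MeasurableMul K] [MeasurableInv K] [MeasurableSMul₂ K X]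
  {σ : Y → X} {e : Z → K} {Θ : K × Y → X} {Θ' : Z × Y → X} {B : Set Y} {Φ : Set Z} {S : Set K}
  (ν : Measure K) [IsMulLeftInvariant ν] [IsMulRightInvariant ν] [SFinite ν]
  (μ : Measure X) [SFinite μ] [SMulInvariantMeasure K X μ]
  {ρ : Measure Y} [SFinite ρ] {κ : Measure Z} [SFinite κ]

/-- ★★ **Global fibred chart identity for a measure-preserving action** (`MulAction` form of
`restrict_tube_eq_map_withDensity`): `μ|_{K•σ(B)} = Θ_*(((ν ⊗ ρ)|_{K×B}) · j)` with the `y`-only density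
`j(k, y) = (∫_Φ J(z, y) dκ(z)) ∕ ν(((eΦ)·S)⁻¹)`, from the local identity on the window `(eΦ)•σ(B)` and the
slice property. [cite: Helgason2000, Ch. I §1 Prop. 1.13 ∕ Thm. 1.14 (PDF pp. 113–114)]
[cite: DearricottEtAl2014, (Searle) Def. 1.11 and properties (1)–(7), PDF pp. 34–35]
[cite: Bredon1972, Ch. II §§4–5] -/
theorem restrict_tube_eq_map_withDensity_smul (hσ : Measurable σ)
    (hΘ : ∀ k y, Θ (k, y) = k • σ y) (hΘm : Measurable Θ)
    (hΘ' : ∀ z y, Θ' (z, y) = e z • σ y) (hΘ'm : Measurable Θ')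
    (hslice : ∀ k : K, ∀ y ∈ B, ∀ y' ∈ B, k • σ y = σ y' → k ∈ S)
    (hfix : ∀ s ∈ S, ∀ y ∈ B, s • σ y = σ y)
    (hT : MeasurableSet (Θ '' (univ ×ˢ B))) (hA : MeasurableSet (Θ' '' (Φ ×ˢ B)))
    {J : Z × Y → ℝ≥0∞} (hJ : Measurable J)
    (hloc : μ.restrict (Θ' '' (Φ ×ˢ B)) =
      (((κ.prod ρ).restrict (Φ ×ˢ B)).withDensity J).map Θ')
    (hc0 : ν (((e '' Φ) * S)⁻¹) ≠ 0) (hctop : ν (((e '' Φ) * S)⁻¹) ≠ ∞) :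
    μ.restrict (Θ '' (univ ×ˢ B)) =
      (((ν.prod ρ).restrict (univ ×ˢ B)).withDensity
        fun z => (∫⁻ p in Φ, J (p, z.2) ∂κ) / ν (((e '' Φ) * S)⁻¹)).map Θ :=
  restrict_tube_eq_map_withDensity (act := fun (k : K) (x : X) => k • x)
    (measurable_fst.smul measurable_snd) (fun k k' x => mul_smul k k' x) (fun x => one_smul K x)
    (fun k => measurePreserving_smul k μ) hσ hΘ hΘm hΘ' hΘ'm hslice hfix hT hA hJ hloc hc0 hctop

end Action

/-! ## §7 Faddeev–Popov localisation of INVARIANT integrands: the tube integral is a multiple of the window integral -/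

section FPLocalisation

variable {K X Y Z : Type*} [Group K] [MeasurableSpace K] [MeasurableMul K] [MeasurableInv K]
  [MeasurableSpace X] {act : K → X → X} {σ : Y → X} {e : Z → K}
  {Θ : K × Y → X} {Θ' : Z × Y → X} {B : Set Y} {Φ : Set Z} {S : Set K}
  {ν : Measure K} [IsMulLeftInvariant ν] [SFinite ν] {μ : Measure X} [SFinite μ]

omit [Group K] [MeasurableSpace K] [MeasurableMul K] [MeasurableInv K] [MeasurableSpace X] [IsMulLeftInvariant ν]
  [SFinite ν] [SFinite μ] in
/-- The product window `Θ'(Φ × B)` lies in the orbit tube `Θ(K × B)` (`Θ'(z, y) = Θ(e z, y)`). [cite: Bredon1972, Ch. II §4] -/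
theorem image_window_subset_tube (hΘ : ∀ k y, Θ (k, y) = act k (σ y))
    (hΘ' : ∀ z y, Θ' (z, y) = act (e z) (σ y)) : Θ' '' (Φ ×ˢ B) ⊆ Θ '' (univ ×ˢ B) := by
  rintro x ⟨⟨z, y⟩, ⟨-, hy⟩, rfl⟩
  exact ⟨(e z, y), ⟨mem_univ _, hy⟩, by rw [hΘ, hΘ']⟩

/-- ★ **Faddeev–Popov localisation, `lintegral` form.**  Under the slice property (as in
`measure_mul_lintegral_tube_eq_window_orbitAverage`), for every INVARIANT measurable `g ≥ 0`
(`g (act k x) = g x`): `ν(((eΦ)·S)⁻¹) · ∫_{Θ(K×B)} g dμ = ν(K) · ∫_{Θ'(Φ×B)} g dμ` — the integral of a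
gauge-invariant function over the orbit tube is the integral over ONE local window, corrected by the orbit-volume
factor `ν(K) ∕ ν(((eΦ)·S)⁻¹)` (the Faddeev–Popov factor of the gauge-fixing function `1_{window}`).
[cite: Creutz2022, Ch. 9 Exercise 4 (PDF p. 44) (gauge-invariant Green's functions with a gauge-fixing function `f`
 and the correction factor `φ(U) = ∫ Π dg f(ᵍU)`)]
[cite: MontvayMunster1994, §3.2.2 (3.237)–(3.239) p. 135 (insertion of the Faddeev–Popov unity)]
[cite: Helgason2000, Ch. I §1 Prop. 1.13 and Thm 1.14 p. 96 (orbit averaging against invariant measures)] -/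
theorem measure_mul_setLIntegral_tube_eq_of_invariant
    (hact : Measurable fun p : K × X => act p.1 p.2)
    (hmul : ∀ k k' x, act (k * k') x = act k (act k' x)) (hone : ∀ x, act 1 x = x)
    (hpres : ∀ k, MeasurePreserving (act k) μ μ)
    (hΘ : ∀ k y, Θ (k, y) = act k (σ y)) (hΘ' : ∀ z y, Θ' (z, y) = act (e z) (σ y))
    (hslice : ∀ k : K, ∀ y ∈ B, ∀ y' ∈ B, act k (σ y) = σ y' → k ∈ S)
    (hfix : ∀ s ∈ S, ∀ y ∈ B, act s (σ y) = σ y)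
    (hT : MeasurableSet (Θ '' (univ ×ˢ B))) (hA : MeasurableSet (Θ' '' (Φ ×ˢ B)))
    {g : X → ℝ≥0∞} (hg : Measurable g) (hginv : ∀ k x, g (act k x) = g x) :
    ν (((e '' Φ) * S)⁻¹) * ∫⁻ x in Θ '' (univ ×ˢ B), g x ∂μ = ν univ * ∫⁻ x in Θ' '' (Φ ×ˢ B), g x ∂μ := by
  rw [measure_mul_lintegral_tube_eq_window_orbitAverage hact hmul hone hpres hΘ hΘ' hslice hfix hT hA hg]
  simp_rw [hginv, lintegral_const]
  rw [lintegral_mul_const _ hg, mul_comm]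

/-- ★ **Faddeev–Popov localisation, real form.**  For `ν` finite (e.g. the Haar probability of a compact gauge group)
and an INVARIANT real `F` integrable on the tube:
`(ν(((eΦ)·S)⁻¹)).toReal · ∫_{Θ(K×B)} F dμ = ν.real(K) · ∫_{Θ'(Φ×B)} F dμ`.  With `ν` a probability and
`c := ν(((eΦ)·S)⁻¹)`: `∫_{tube} F dμ = c⁻¹ ∫_{window} F dμ` — the form in which a Gibbs weight `e^{−βf}φ` with invariant
`f, φ` is handed from the orbit tube to a local product chart (`tendsto_laplaceMethod_fibred_chart_of_support`).
[cite: Creutz2022, Ch. 9 Exercise 4 (PDF p. 44)] [cite: MontvayMunster1994, §3.2.2 (3.237)–(3.239) p. 135]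
[cite: Helgason2000, Ch. I §1 Thm 1.14 p. 96] -/
theorem measureReal_mul_setIntegral_tube_eq_of_invariant [IsFiniteMeasure ν]
    (hact : Measurable fun p : K × X => act p.1 p.2)
    (hmul : ∀ k k' x, act (k * k') x = act k (act k' x)) (hone : ∀ x, act 1 x = x)
    (hpres : ∀ k, MeasurePreserving (act k) μ μ)
    (hΘ : ∀ k y, Θ (k, y) = act k (σ y)) (hΘ' : ∀ z y, Θ' (z, y) = act (e z) (σ y))
    (hslice : ∀ k : K, ∀ y ∈ B, ∀ y' ∈ B, act k (σ y) = σ y' → k ∈ S)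
    (hfix : ∀ s ∈ S, ∀ y ∈ B, act s (σ y) = σ y)
    (hT : MeasurableSet (Θ '' (univ ×ˢ B))) (hA : MeasurableSet (Θ' '' (Φ ×ˢ B)))
    {F : X → ℝ} (hFm : Measurable F) (hFinv : ∀ k x, F (act k x) = F x)
    (hFint : IntegrableOn F (Θ '' (univ ×ˢ B)) μ) :
    (ν (((e '' Φ) * S)⁻¹)).toReal * ∫ x in Θ '' (univ ×ˢ B), F x ∂μ =
      ν.real univ * ∫ x in Θ' '' (Φ ×ˢ B), F x ∂μ := by
  have hFintW : IntegrableOn F (Θ' '' (Φ ×ˢ B)) μ := hFint.mono_set (image_window_subset_tube hΘ hΘ')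
  have hm₁ : Measurable fun x => ENNReal.ofReal (F x) := ENNReal.measurable_ofReal.comp hFm
  have hm₂ : Measurable fun x => ENNReal.ofReal (-F x) := ENNReal.measurable_ofReal.comp hFm.neg
  have hpos := measure_mul_setLIntegral_tube_eq_of_invariant (ν := ν) hact hmul hone hpres hΘ hΘ' hslice hfix hT hA
    hm₁ (fun k x => by simp only [hFinv])
  have hneg := measure_mul_setLIntegral_tube_eq_of_invariant (ν := ν) hact hmul hone hpres hΘ hΘ' hslice hfix hT hA
    hm₂ (fun k x => by simp only [hFinv])
  rw [integral_eq_lintegral_pos_part_sub_lintegral_neg_part hFint,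
    integral_eq_lintegral_pos_part_sub_lintegral_neg_part hFintW, mul_sub, ← ENNReal.toReal_mul,
    ← ENNReal.toReal_mul, hpos, hneg, ENNReal.toReal_mul, ENNReal.toReal_mul, measureReal_def, mul_sub]

end FPLocalisation

end Literature.MeasureTheory.Group
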